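import Summits.BirchSwinnertonDyer.Rank1Residual.Additive.BranchPAdicGrossZagierUpperHalf
import Summits.BirchSwinnertonDyer.Rank1Residual.Additive.GordBranchPAdicGrossZagierOddConverse
import Summits.BirchSwinnertonDyer.Rank1Residual.AdditivePotMult.PotMultBranchPAdicGrossZagierConverse
import Summits.BirchSwinnertonDyer.Rank1Residual.Additive.GordBranchPAdicGrossZagierOddThree
import Literature.NumberTheory.EllipticCurves.Pal2012.QuadraticTwistPeriodProofs
import HarnessLib

/-!
# T-O7c (iv), the loop CLOSED: on every big-image semistable-twist row of O7-ord in analytic rank one,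
# GIVEN the branch main conjecture (our typed LOWER ∧ Kato's published UPPER) and Delbourgo 2002
# (A)+(B) with the Schneider rider, `BSD(E,p)` holds IF AND ONLY IF the typed branch `p`-adic
# Gross–Zagier holds for every (B)-datum — literal kernel iffs, (G-ord) even / odd (`p = 3` included) /
# (M) (cell `b2b-bsdres`, team n1011, seat p01 GEN 2, OWNERS row T-O7c; capstone of
# `GordBranchPAdicGrossZagier{,Odd}{,Converse}.lean`, `PotMultBranchPAdicGrossZagier{,RankOne,Converse}.lean`,
# `BranchPAdicGrossZagierUpperHalf.lean`)

HONEST FRAMING (cell `b2b-bsdres`, run/shared/lean/b2b/bsd-rank1-residual/, verbatim in every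
file): prove what is provable now; shrink each hard class to its core with data; no claim beyond
stated classes. Research routes; census output = EVIDENCE / conjecture items, never a Literature
fact; RESIDUAL-MAP marks change only by signed lines. §I O7 stays OPEN; X4♯(G-ord) / X4(M) stay
CONSTRUCTION-SHAPED; nothing is booked; no label changes. COVERAGE (stated first, referee 1
proviso): X4 ∧ {`ρ̄_{E,p}` onto} ∧ `r_an = 1` on the semistable-twist locus: (G-ord) defect 2
(`I₀*`) at `p ≡ 1 (mod 4)` (non-CM, non-anomalous, A175), at `p ≡ 3 (mod 4)`, `p ≥ 7` (same), and at
`p = 3` (non-CM, non-anomalous, p16's `Delbourgo2002.mainTheorem_three`); (M) at EVERY odd `p` (A190;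
`ℓ = 1`, no CM automatic). NO definition, NO Literature fact minted, NO `_holds` of a NEW fact;
theorems only. Pal 2012 Thm. 3.2 enters gen 1's even-branch lower half as the tree THEOREM
`Pal2012.thm32_sqrt_mul_realPeriodRat_twist_eq_of_prime_one_mod_four_holds` (additive-p4), so no
`hPal` binder survives here (item (iii) of the row).

## What

For each row type, two theorems:
* `…bsdp_rankOne_of_…_of_branchPAdicGrossZagier…`: published inputs (Delbourgo (A)+(B) `hDel`/`hDel3`/
  `hDelM`, Kato's half `hK`, modularity `hmod`/`hmodD`, GZK) ∧ our typed LOWER (`hdiv`/`hc`) ∧ [for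
  every (B)-datum: rider ∧ typed `p`-adic GZ] ⟹ `BSDp W p` — lower half by gen 1's factorisation,
  upper half by `BranchPAdicGrossZagierUpperHalf.lean`, glued by `Typed.missingPPartAt_of_lower_of_upper`.
* `…bsdp_iff_forall_branchPAdicGrossZagier…`: under the same published inputs + typed LOWER + the
  rider for every (B)-datum (`hSall`, EVIDENCE binder): `BSDp W p ↔ ∀ Dh, LeadingTermClauses W p Dh →
  BranchPAdicGrossZagier…At W p Dh` ((→) = the converses of gen 1 / this gen).
So the typed branch `p`-adic Gross–Zagier is, on these rows and modulo the branch IMC + rider,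
LITERALLY EQUIVALENT to the `p`-part of BSD: it is the missing analytic input and nothing more.

References: [Delbourgo2002] Thm. (A), (B), Example p. 40; [Kato2004Asterisque] Thm. 17.4 (3);
[Wuthrich2014] §3, Cor. 19, Lemma 20; [Pal2012] Thm. 3.2; [MazurTateTeitelbaum1986Invent] §I.13–I.14;
[Miller2011LMS] Def. 1.1; [GreenbergLNM1716] §5.
-/

noncomputable section

open scoped Classical MatrixGroups ModularForm NumberField

open CongruenceSubgroup WeierstrassCurve NumberField Literature.NumberTheory.EllipticCurves
  Literature.NumberTheory.EllipticCurves.ModularForms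
  Literature.NumberTheory.EllipticCurves.Rank1Residual
  Literature.NumberTheory.EllipticCurves.Rank1Residual.Typed
  Literature.NumberTheory.EllipticCurves.Delbourgo2002
  Literature.NumberTheory.GaloisRepresentations
  IsDedekindDomain

namespace Summit.BirchSwinnertonDyer.Rank1Residual.Additive

variable {W : WeierstrassCurve ℚ} [W.IsElliptic] [W.IsGloballyMinimal] {p : ℕ} [hp : Fact p.Prime]

/-! ### §1 Defect 2, even branch (`p ≡ 1 (mod 4)`) -/

/-- **X4♯(G-ord) ∩ `I₀*` ∩ {`ρ̄` onto}, `p ≡ 1 (mod 4)`, non-CM, non-anomalous, `r_an = 1`: `BSD(E,p)`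
from the branch IMC (p07's typed LOWER `hdiv` + Kato's half, published) ∧ Delbourgo 2002 (A)+(B) (A175)
∧ [rider ∧ typed even-branch `p`-adic Gross–Zagier for every (B)-datum].** Lower half: gen 1's
`ClassX4Gord.missingLowerBoundAt_rankOne_of_chiBranchLower_of_branchPAdicGrossZagier` (Pal 2012 Thm.
3.2 = tree theorem); upper half: `ClassX4Gord.missingUpperBoundAt_rankOne_of_katoHalf_of_schneider_of_branchPAdicGrossZagier`
(rider variant of additive-p2's). X4♯(G-ord) stays CONSTRUCTION-SHAPED; nothing booked. [cite: Delbourgo2002, Theorem (A), (B) (p. 40)]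
[cite: Kato2004Asterisque, Thm. 17.4 (3) (p. 273)] [cite: Pal2012, Thm. 3.2] [cite: Miller2011LMS, Def. 1.1] -/
theorem ClassX4Gord.bsdp_rankOne_of_chiBranchLower_of_katoHalf_of_branchPAdicGrossZagier
    (hDel : Delbourgo2002.mainTheorem)
    (hK : Wuthrich2014.kato_halfEigenCharIdeal_dvd_cyclotomicPrime_of_surjective)
    (hmod : hasEntireLFunction_rat) (hmodD : nonempty_modularParametrizationData)
    (hGZK : rank_eq_analyticRank_of_analyticRank_le_one) (hX : ClassX4Gord W p)
    (he : semistabilityIndex W p = 2) (hp4 : p % 4 = 1) (hcm : ¬ W.HasCM)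
    (hna : ReductionNonAnomalous W p) (hsurj : Surj W p) (hr : W.analyticRank = 1)
    (hdiv : ChiBranchLowerDivisibilityAt W p)
    (hGZ : ∀ Dh : PAdicHeightData W p, LeadingTermClauses W p Dh →
      SchneiderConjecture Dh ∧ BranchPAdicGrossZagierAt W p Dh) : BSDp W p := by
  have hp5 : 5 ≤ p := by have := hp.out.two_le; omega
  have hl : MissingLowerBoundAt W p :=
    hX.missingLowerBoundAt_rankOne_of_chiBranchLower_of_branchPAdicGrossZagier hDel
      Pal2012.thm32_sqrt_mul_realPeriodRat_twist_eq_of_prime_one_mod_four_holds hmod hmodD hGZK he hp4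
      hp5 hcm hna hr hdiv hGZ
  obtain ⟨Dh, hB⟩ := hDel.exists_leadingTermClauses hp5 hcm hX.1.2.1 hX.2
  obtain ⟨hS, hGZDh⟩ := hGZ Dh hB
  have hu : MissingUpperBoundAt W p :=
    hX.missingUpperBoundAt_rankOne_of_katoHalf_of_schneider_of_branchPAdicGrossZagier hK hGZK hmod hmodD
      he hp4 hsurj hr hB hS hGZDh
  exact bsdp_of_missingPPartAt W p hGZK (by rw [hr]) (missingPPartAt_of_lower_of_upper W p hl hu)

/-- **THE LOOP CLOSED, even branch (iff).** X4♯(G-ord) ∩ `I₀*` ∩ {`ρ̄` onto}, `p ≡ 1 (mod 4)`, non-CM,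
non-anomalous, `r_an = 1`; GIVEN the branch IMC (typed LOWER `hdiv` + Kato's half), Delbourgo 2002
(A)+(B), modularity, GZK, and the Schneider rider for every (B)-datum (`hSall`, EVIDENCE): `BSD(E,p)
⟺` the typed even-branch `p`-adic Gross–Zagier holds for every (B)-datum.
[cite: Delbourgo2002, Theorem (A), (B) (p. 40)] [cite: Kato2004Asterisque, Thm. 17.4 (3) (p. 273)]
[cite: Miller2011LMS, Def. 1.1] -/
theorem ClassX4Gord.bsdp_iff_forall_branchPAdicGrossZagierAt_of_chiBranchLower_of_katoHalf
    (hDel : Delbourgo2002.mainTheorem)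
    (hK : Wuthrich2014.kato_halfEigenCharIdeal_dvd_cyclotomicPrime_of_surjective)
    (hmod : hasEntireLFunction_rat) (hmodD : nonempty_modularParametrizationData)
    (hGZK : rank_eq_analyticRank_of_analyticRank_le_one) (hX : ClassX4Gord W p)
    (he : semistabilityIndex W p = 2) (hp4 : p % 4 = 1) (hcm : ¬ W.HasCM)
    (hna : ReductionNonAnomalous W p) (hsurj : Surj W p) (hr : W.analyticRank = 1)
    (hdiv : ChiBranchLowerDivisibilityAt W p)
    (hSall : ∀ Dh : PAdicHeightData W p, LeadingTermClauses W p Dh → SchneiderConjecture Dh) :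
    BSDp W p ↔ ∀ Dh : PAdicHeightData W p, LeadingTermClauses W p Dh → BranchPAdicGrossZagierAt W p Dh := by
  have hp5 : 5 ≤ p := by have := hp.out.two_le; omega
  refine ⟨fun hbsd Dh hB ↦ ?_, fun hGZ ↦ ?_⟩
  · exact hX.branchPAdicGrossZagierAt_of_bsdp_of_chiBranchLower_of_kato
      (Kato2004.charIdeal_dvd_padicLFunctionBranch_component_of_surjective_of_half hK) hmod hsurj hp5 hr
      hna hbsd hdiv hB (hSall Dh hB)
  · exact hX.bsdp_rankOne_of_chiBranchLower_of_katoHalf_of_branchPAdicGrossZagier hDel hK hmod hmodD hGZK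
      he hp4 hcm hna hsurj hr hdiv fun Dh hB ↦ ⟨hSall Dh hB, hGZ Dh hB⟩

/-! ### §2 Defect 2, odd branch (`p ≡ 3 (mod 4)`, `p ≥ 7`) -/

/-- **X4♯(G-ord) ∩ `I₀*` ∩ {`ρ̄` onto}, `p ≡ 3 (mod 4)`, `p ≥ 5` (i.e. `p ≥ 7`), non-CM, non-anomalous,
`r_an = 1`: `BSD(E,p)` from the branch IMC (p07's typed odd LOWER `hdiv` + Kato's half) ∧ Delbourgo
2002 (A)+(B) (A175) ∧ [rider ∧ typed odd-branch `p`-adic GZ for every (B)-datum].**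
[cite: Delbourgo2002, Theorem (A), (B) (p. 40)] [cite: Kato2004Asterisque, Thm. 17.4 (3) (p. 273)]
[cite: Miller2011LMS, Def. 1.1] -/
theorem ClassX4Gord.bsdp_rankOne_of_chiBranchLowerOdd_of_katoHalf_of_branchPAdicGrossZagierOdd
    (hDel : Delbourgo2002.mainTheorem)
    (hK : Wuthrich2014.kato_halfEigenCharIdeal_dvd_cyclotomicPrime_of_surjective)
    (hmod : hasEntireLFunction_rat) (hmodD : nonempty_modularParametrizationData)
    (hGZK : rank_eq_analyticRank_of_analyticRank_le_one) (hX : ClassX4Gord W p)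
    (he : semistabilityIndex W p = 2) (hp4 : p % 4 = 3) (hp5 : 5 ≤ p) (hcm : ¬ W.HasCM)
    (hna : ReductionNonAnomalous W p) (hsurj : Surj W p) (hr : W.analyticRank = 1)
    (hdiv : ChiBranchLowerDivisibilityOddAt W p)
    (hGZ : ∀ Dh : PAdicHeightData W p, LeadingTermClauses W p Dh →
      SchneiderConjecture Dh ∧ BranchPAdicGrossZagierOddAt W p Dh) : BSDp W p := by
  have hl : MissingLowerBoundAt W p :=
    hX.missingLowerBoundAt_rankOne_of_chiBranchLowerOdd_of_branchPAdicGrossZagierOdd hDel hmod hmodD hGZK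
      he hp4 hp5 hcm hna hr hdiv hGZ
  obtain ⟨Dh, hB⟩ := hDel.exists_leadingTermClauses hp5 hcm hX.1.2.1 hX.2
  obtain ⟨hS, hGZDh⟩ := hGZ Dh hB
  have hu : MissingUpperBoundAt W p :=
    hX.missingUpperBoundAt_rankOne_of_katoHalf_of_branchPAdicGrossZagierOdd hK hGZK hmod hmodD he hp4
      hsurj hr hB hS hGZDh
  exact bsdp_of_missingPPartAt W p hGZK (by rw [hr]) (missingPPartAt_of_lower_of_upper W p hl hu)

/-- **THE LOOP CLOSED, odd branch, `p ≥ 7` (iff).** X4♯(G-ord) ∩ `I₀*` ∩ {`ρ̄` onto}, `p ≡ 3 (mod 4)`,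
`p ≥ 5`, non-CM, non-anomalous, `r_an = 1`; GIVEN the branch IMC (typed odd LOWER + Kato's half),
Delbourgo 2002 (A)+(B), modularity, GZK, and the rider for every (B)-datum: `BSD(E,p) ⟺` the typed
odd-branch `p`-adic Gross–Zagier for every (B)-datum. [cite: Delbourgo2002, Theorem (A), (B) (p. 40)]
[cite: Kato2004Asterisque, Thm. 17.4 (3) (p. 273)] [cite: Miller2011LMS, Def. 1.1] -/
theorem ClassX4Gord.bsdp_iff_forall_branchPAdicGrossZagierOddAt_of_chiBranchLowerOdd_of_katoHalf
    (hDel : Delbourgo2002.mainTheorem)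
    (hK : Wuthrich2014.kato_halfEigenCharIdeal_dvd_cyclotomicPrime_of_surjective)
    (hmod : hasEntireLFunction_rat) (hmodD : nonempty_modularParametrizationData)
    (hGZK : rank_eq_analyticRank_of_analyticRank_le_one) (hX : ClassX4Gord W p)
    (he : semistabilityIndex W p = 2) (hp4 : p % 4 = 3) (hp5 : 5 ≤ p) (hcm : ¬ W.HasCM)
    (hna : ReductionNonAnomalous W p) (hsurj : Surj W p) (hr : W.analyticRank = 1)
    (hdiv : ChiBranchLowerDivisibilityOddAt W p)
    (hSall : ∀ Dh : PAdicHeightData W p, LeadingTermClauses W p Dh → SchneiderConjecture Dh) :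
    BSDp W p ↔
      ∀ Dh : PAdicHeightData W p, LeadingTermClauses W p Dh → BranchPAdicGrossZagierOddAt W p Dh := by
  refine ⟨fun hbsd Dh hB ↦ ?_, fun hGZ ↦ ?_⟩
  · exact hX.branchPAdicGrossZagierOddAt_of_bsdp_of_chiBranchLowerOdd_of_katoHalf hK hmod hsurj hr hna
      hbsd hdiv hB (hSall Dh hB)
  · exact hX.bsdp_rankOne_of_chiBranchLowerOdd_of_katoHalf_of_branchPAdicGrossZagierOdd hDel hK hmod
      hmodD hGZK he hp4 hp5 hcm hna hsurj hr hdiv fun Dh hB ↦ ⟨hSall Dh hB, hGZ Dh hB⟩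

end Summit.BirchSwinnertonDyer.Rank1Residual.Additive

/-! ### §3 Defect 2, odd branch at `p = 3` (p16's `Delbourgo2002.mainTheorem_three` for A175; the
forward `p = 3` class form is n1011-p12's `GordBranchPAdicGrossZagierOddThree.lean`, imported) -/

namespace Summit.BirchSwinnertonDyer.Rank1Residual.Additive

variable {W : WeierstrassCurve ℚ} [W.IsElliptic] [W.IsGloballyMinimal] [h3 : Fact (Nat.Prime 3)]

/-- **X4♯(G-ord)@3 ∩ `I₀*` ∩ {`ρ̄_{E,3}` onto}, non-CM, non-anomalous, `r_an = 1`: `BSD(E,3)` from the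
branch IMC at `3` (typed odd LOWER + Kato's half — the 3-adic tower from surj(3) by Lemma 20) ∧
Delbourgo 2002 at `3` (p16's `mainTheorem_three`) ∧ [rider ∧ typed odd-branch 3-adic GZ for every
(B)-datum].** Defect `2` is AUTOMATIC at `3` (`semistabilityIndex_eq_two_of_typeG_three`); lower half =
n1011-p12's `ClassX4Gord.missingLowerBoundAt_three_rankOne_of_chiBranchLowerOdd_of_branchPAdicGrossZagierOdd`
(p254718), upper half = `…_of_katoHalf_of_branchPAdicGrossZagierOdd` at `3`. [cite: Delbourgo2002, Theorem (A), (B), Example (p. 40)] [cite: Kato2004Asterisque, Thm. 17.4 (3) (p. 273)]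
[cite: Wuthrich2014, Lemma 20 (p. 399)] [cite: Miller2011LMS, Def. 1.1] -/
theorem ClassX4Gord.bsdp_three_rankOne_of_chiBranchLowerOdd_of_katoHalf_of_branchPAdicGrossZagierOdd
    (hDel3 : Delbourgo2002.mainTheorem_three)
    (hK : Wuthrich2014.kato_halfEigenCharIdeal_dvd_cyclotomicPrime_of_surjective)
    (hmod : hasEntireLFunction_rat) (hmodD : nonempty_modularParametrizationData)
    (hGZK : rank_eq_analyticRank_of_analyticRank_le_one) (hX : ClassX4Gord W 3)
    (hcm : ¬ W.HasCM) (hna : ReductionNonAnomalous W 3)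
    (hsurj : Surj W 3) (hr : W.analyticRank = 1) (hdiv : ChiBranchLowerDivisibilityOddAt W 3)
    (hGZ : ∀ Dh : PAdicHeightData W 3, LeadingTermClauses W 3 Dh →
      SchneiderConjecture Dh ∧ BranchPAdicGrossZagierOddAt W 3 Dh) : BSDp W 3 := by
  have he : semistabilityIndex W 3 = 2 :=
    semistabilityIndex_eq_two_of_typeG_three W hX.typeGOrd.typeG hX.addv.2
  have hl : MissingLowerBoundAt W 3 :=
    hX.missingLowerBoundAt_three_rankOne_of_chiBranchLowerOdd_of_branchPAdicGrossZagierOdd hDel3 hmod hmodD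
      hGZK hcm hna hr hdiv hGZ
  obtain ⟨-, Dh, hB⟩ := hX.delbourgo2002_three hDel3 hcm
  obtain ⟨hS, hGZDh⟩ := hGZ Dh hB
  have hu : MissingUpperBoundAt W 3 :=
    hX.missingUpperBoundAt_rankOne_of_katoHalf_of_branchPAdicGrossZagierOdd hK hGZK hmod hmodD he
      (by norm_num) hsurj hr hB hS hGZDh
  exact bsdp_of_missingPPartAt W 3 hGZK (by rw [hr]) (missingPPartAt_of_lower_of_upper W 3 hl hu)

/-- **THE LOOP CLOSED at `p = 3`, odd branch (iff).** X4♯(G-ord)@3 ∩ `I₀*` ∩ {`ρ̄_{E,3}` onto}, non-CM,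
non-anomalous, `r_an = 1`; GIVEN the branch IMC at `3`, Delbourgo 2002 at `3`, modularity, GZK and the
rider for every (B)-datum: `BSD(E,3) ⟺` the typed odd-branch 3-adic Gross–Zagier for every (B)-datum.
[cite: Delbourgo2002, Theorem (A), (B), Example (p. 40)] [cite: Kato2004Asterisque, Thm. 17.4 (3) (p. 273)]
[cite: Miller2011LMS, Def. 1.1] -/
theorem ClassX4Gord.bsdp_three_iff_forall_branchPAdicGrossZagierOddAt_of_chiBranchLowerOdd_of_katoHalf
    (hDel3 : Delbourgo2002.mainTheorem_three)
    (hK : Wuthrich2014.kato_halfEigenCharIdeal_dvd_cyclotomicPrime_of_surjective)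
    (hmod : hasEntireLFunction_rat) (hmodD : nonempty_modularParametrizationData)
    (hGZK : rank_eq_analyticRank_of_analyticRank_le_one) (hX : ClassX4Gord W 3)
    (hcm : ¬ W.HasCM) (hna : ReductionNonAnomalous W 3)
    (hsurj : Surj W 3) (hr : W.analyticRank = 1) (hdiv : ChiBranchLowerDivisibilityOddAt W 3)
    (hSall : ∀ Dh : PAdicHeightData W 3, LeadingTermClauses W 3 Dh → SchneiderConjecture Dh) :
    BSDp W 3 ↔
      ∀ Dh : PAdicHeightData W 3, LeadingTermClauses W 3 Dh → BranchPAdicGrossZagierOddAt W 3 Dh := by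
  refine ⟨fun hbsd Dh hB ↦ ?_, fun hGZ ↦ ?_⟩
  · exact hX.branchPAdicGrossZagierOddAt_of_bsdp_of_chiBranchLowerOdd_of_katoHalf hK hmod hsurj hr hna
      hbsd hdiv hB (hSall Dh hB)
  · exact hX.bsdp_three_rankOne_of_chiBranchLowerOdd_of_katoHalf_of_branchPAdicGrossZagierOdd hDel3 hK
      hmod hmodD hGZK hcm hna hsurj hr hdiv fun Dh hB ↦ ⟨hSall Dh hB, hGZ Dh hB⟩

end Summit.BirchSwinnertonDyer.Rank1Residual.Additive

/-! ### §4 (M), every odd `p` -/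

namespace Summit.BirchSwinnertonDyer.Rank1Residual.AdditivePotMult

open Additive

variable {W : WeierstrassCurve ℚ} [W.IsElliptic] [W.IsGloballyMinimal] {p : ℕ} [hp : Fact p.Prime]

/-- **X4(M) ∩ {`ρ̄_{E,p}` onto}, EVERY odd `p` (`p = 3` included), `r_an = 1`: `BSD(E,p)` from the branch
IMC on `E♭`'s quadratic branch (p10's typed LOWER `hc` on every multiplicative twist model + Kato's
half, published, via n1011-p07's brick) ∧ Delbourgo 2002 (A)+(B) in case (M) (A190, `hDelM`) ∧ [rider
∧ typed (M) `p`-adic GZ for every (B)-datum].** Lower half: gen 1's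
`ClassX4M.missingLowerBoundAt_rankOne_of_quadraticBranchLower_of_branchPAdicGrossZagierMult`; upper
half: `ClassX4M.missingUpperBoundAt_rankOne_of_katoHalf_of_branchPAdicGrossZagierMult`. `ℓ = 1`, no CM,
tower AUTOMATIC. X4(M) stays CONSTRUCTION-SHAPED; nothing booked.
[cite: Delbourgo2002, Theorem (A), (B), Hypothesis (p. 39), Example (p. 40)]
[cite: Kato2004Asterisque, Thm. 17.4 (3) (p. 273)] [cite: Miller2011LMS, Def. 1.1] -/
theorem ClassX4M.bsdp_rankOne_of_quadraticBranchLower_of_katoHalf_of_branchPAdicGrossZagierMult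
    (hDelM : Delbourgo2002.mainTheorem_potMult)
    (hK : Wuthrich2014.kato_halfEigenCharIdeal_dvd_cyclotomicPrime_of_surjective)
    (hmod : hasEntireLFunction_rat) (hmodD : nonempty_modularParametrizationData)
    (hGZK : rank_eq_analyticRank_of_analyticRank_le_one) (hX : ClassX4M W p) (hsurj : Surj W p)
    (hr : W.analyticRank = 1)
    (hc : ∀ (V : WeierstrassCurve ℚ) [V.IsElliptic] [V.IsGloballyMinimal],
      (∃ C : VariableChange ℚ, C • V.quadraticTwist ((-1) ^ (p / 2) * p : ℚ) = W) →
        QuadraticBranchLowerDivisibilityAt V p)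
    (hGZ : ∀ Dh : PAdicHeightData W p, LeadingTermClauses W p Dh →
      SchneiderConjecture Dh ∧ BranchPAdicGrossZagierMultAt W p Dh) : BSDp W p := by
  have hl : MissingLowerBoundAt W p :=
    hX.missingLowerBoundAt_rankOne_of_quadraticBranchLower_of_branchPAdicGrossZagierMult hDelM hmod hmodD
      hGZK hr hc hGZ
  obtain ⟨-, Dh, hB⟩ := hX.delbourgo2002 hDelM
  obtain ⟨hS, hGZDh⟩ := hGZ Dh hB
  have hu : MissingUpperBoundAt W p :=
    hX.missingUpperBoundAt_rankOne_of_katoHalf_of_branchPAdicGrossZagierMult hK hGZK hmod hmodD hsurj hr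
      hB hS hGZDh
  exact bsdp_of_missingPPartAt W p hGZK (by rw [hr]) (missingPPartAt_of_lower_of_upper W p hl hu)

/-- **THE LOOP CLOSED on (M) (iff), EVERY odd `p`.** X4(M) ∩ {`ρ̄_{E,p}` onto}, `r_an = 1`; GIVEN the
branch IMC on `E♭` (p10's typed LOWER on every multiplicative twist model + Kato's half), Delbourgo
2002 (M), modularity, GZK, and the rider for every (B)-datum (`hSall`): `BSD(E,p) ⟺` the typed (M)
`p`-adic Gross–Zagier holds for every (B)-datum. [cite: Delbourgo2002, Theorem (A), (B), Example (p. 40)]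
[cite: Kato2004Asterisque, Thm. 17.4 (3) (p. 273)] [cite: Miller2011LMS, Def. 1.1] -/
theorem ClassX4M.bsdp_iff_forall_branchPAdicGrossZagierMultAt_of_quadraticBranchLower_of_katoHalf
    (hDelM : Delbourgo2002.mainTheorem_potMult)
    (hK : Wuthrich2014.kato_halfEigenCharIdeal_dvd_cyclotomicPrime_of_surjective)
    (hmod : hasEntireLFunction_rat) (hmodD : nonempty_modularParametrizationData)
    (hGZK : rank_eq_analyticRank_of_analyticRank_le_one) (hX : ClassX4M W p) (hsurj : Surj W p)
    (hr : W.analyticRank = 1)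
    (hc : ∀ (V : WeierstrassCurve ℚ) [V.IsElliptic] [V.IsGloballyMinimal],
      (∃ C : VariableChange ℚ, C • V.quadraticTwist ((-1) ^ (p / 2) * p : ℚ) = W) →
        QuadraticBranchLowerDivisibilityAt V p)
    (hSall : ∀ Dh : PAdicHeightData W p, LeadingTermClauses W p Dh → SchneiderConjecture Dh) :
    BSDp W p ↔
      ∀ Dh : PAdicHeightData W p, LeadingTermClauses W p Dh → BranchPAdicGrossZagierMultAt W p Dh := by
  refine ⟨fun hbsd Dh hB ↦ ?_, fun hGZ ↦ ?_⟩
  · exact hX.branchPAdicGrossZagierMultAt_of_bsdp_of_quadraticBranchLower_of_katoHalf hK hmod hsurj hr hbsd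
      hc hB (hSall Dh hB)
  · exact hX.bsdp_rankOne_of_quadraticBranchLower_of_katoHalf_of_branchPAdicGrossZagierMult hDelM hK hmod
      hmodD hGZK hsurj hr hc fun Dh hB ↦ ⟨hSall Dh hB, hGZ Dh hB⟩

end Summit.BirchSwinnertonDyer.Rank1Residual.AdditivePotMult

end
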